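import Mathlib
import HarnessLib
import Summits.NavierStokesRegularity.NavierStokesRegularity.Theorems.TypeILiouvilleStrainLedgerStarved
import Summits.NavierStokesRegularity.NavierStokesRegularity.Theorems.TypeILiouvilleShorelineAnalytic

/-!
# TypeILiouvilleStrainLedgerStretchingFloor — crux (L) stmt-NavierStokesRegularity-10661 `TypeIliouvilleL`,
# registered stub `stub_quiescentLiouville` (L_Q): A NON-CONSTANT BOUNDED ANCIENT FLOW HAS STRETCHING NUMBER ≥ 1
# INFINITELY OFTEN IN THE PAST

Helper for stmt-NavierStokesRegularity-10661 (`--supports`); theorems only, no definitions, no named-fact hypotheses;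
closes no item; Navier–Stokes regularity is NOT proved here (leafhand seat of the EulerZoomLiouville route).

Class P = print's class of bounded ancient mild solutions (continuous and bounded on `(−∞,0) × ℝ³`, weakly divergence
free, Oseen integral equation).  Inputs: the harmonic gradient floor `const_of_norm_fderiv_le_div` of
`TypeILiouvilleStrainLedgerStarved` (`‖∇v(τ,x)‖ ≤ a/(−τ)`, `a < 1` ⟹ constant), time-translation invariance of class P
(`classP_timeShift`, this file), and one-slice forward rigidity `classP_const_after_of_const_slice` of
`TypeILiouvilleShorelineAnalytic`.

* `classP_timeShift` — `t ↦ v (t + T)` is again in class P for `T ≤ 0`; `classP_const_of_const_below` — constant on a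
  far past ⟹ constant.
* `exists_stretching_gt_of_nonconst_below` — if `v` is not constant on `(−∞,T) × ℝ³` (`T ≤ 0`) then for every `a < 1`
  there are `τ < T` and `x` with `(T − τ)·‖∇v(τ,x)‖ > a`.
* `exists_stretching_gt_of_nonconst` — for a NON-CONSTANT class-P flow, every `T < 0` and every `a < 1`: some `τ < T`,
  `x` with `(T − τ)·‖∇v(τ,x)‖ > a`, in particular `(−τ)·‖∇v(τ,x)‖ > a`;
  `frequently_stretching_gt_of_nonconst` — `∃ᶠ τ → −∞, ∃ x, (−τ)‖∇v(τ,x)‖ > a` (Filter form);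
  `const_of_eventually_stretching_le`, `const_of_eventually_stretching_lt_vorticity_decay` — the Liouville forms
  (eventual stretching number `≤ a < 1`; or eventual stretching exponent `a` below the vorticity-decay exponent `β`).

READING on L_Q (with `TypeILiouvilleQuiescentGradient`: quiescent ⟺ `G(τ) := sup_x‖∇v(τ,·)‖ → 0`): a counterexample to
L_Q fades, but never faster than the Type-I clock — `limsup_{τ→−∞} (−τ)·G(τ) ≥ 1`; the print-class face of the unit
stretching threshold of door stmt-4050, now a kernel theorem with NO Type-I hypothesis on `v` itself.  Nearest tree
item: `ClockStretchingLaw.SmallStrainRung` (stmt-10574, PROVED: smooth Type-I KNSS-mild, `(−t)‖∇u‖ ≤ ½` for ALL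
`t < 0` ⟹ `u ≡ 0`, «any constant < 1 works»); delta here: print's BOUNDED class (no decay, no smoothness assumed),
threshold `1`, hypothesis only on a far past `τ < T`, conclusion «constant» (`const_of_eventually_stretching_le`).
[cite: KochNadirashviliSereginSverak2009, §4 (arXiv:0709.3599); MajdaBertozzi2002, eq. (3.80)]
-/

noncomputable section
open MeasureTheory Filter Set Function Metric
open scoped Topology RealInnerProductSpace ENNReal NNReal
open Literature.Analysis Literature.Analysis.FluidPDE Literature.Analysis.UnboundedOperators
set_option linter.dupNamespace false
namespace Summit.NavierStokesRegularity.NavierStokesRegularity.Theorems.TypeILiouvilleStrainLedger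

/-- **Class P is invariant under time translation into the past**: for `T ≤ 0` the field `t ↦ v (t + T)` is again
continuous and bounded on `(−∞,0) × ℝ³`, weakly divergence free, and Oseen-mild (`oseenDuhamel_comp_sub_right`); the
`x₀ = 0` case of the tree's `TypeILiouvilleQuiescentShadow.printClass_translate`, re-proved here to keep this file's imports
route-independent. [cite: KochNadirashviliSereginSverak2009, §4 p. 8 (arXiv:0709.3599)] -/
theorem classP_timeShift
    {v : ℝ → EuclideanSpace ℝ (Fin 3) → EuclideanSpace ℝ (Fin 3)}
    (hc : ContinuousOn (uncurry v) (Iio 0 ×ˢ univ))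
    (hK : ∃ K : ℝ, ∀ t < 0, ∀ x, ‖v t x‖ ≤ K)
    (hd : ∀ t < 0, IsWeaklyDivFree (v t))
    (hm : ∀ s t : ℝ, s < t → t < 0 → ∀ x,
      v t x = heatExtension (v s) (t - s) x - oseenDuhamel 1 s v v t x)
    {T : ℝ} (hT : T ≤ 0) :
    ContinuousOn (uncurry fun t x => v (t + T) x) (Iio 0 ×ˢ univ) ∧
    (∃ K : ℝ, ∀ t < 0, ∀ x, ‖v (t + T) x‖ ≤ K) ∧
    (∀ t < 0, IsWeaklyDivFree (v (t + T))) ∧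
    (∀ s t : ℝ, s < t → t < 0 → ∀ x,
      v (t + T) x = heatExtension (v (s + T)) (t - s) x -
        oseenDuhamel 1 s (fun τ => v (τ + T)) (fun τ => v (τ + T)) t x) := by
  refine ⟨?_, ?_, fun t ht => hd (t + T) (by linarith), fun s t hst ht x => ?_⟩
  · have hmap : ContinuousOn (fun p : ℝ × EuclideanSpace ℝ (Fin 3) => (p.1 + T, p.2)) (Iio 0 ×ˢ univ) :=
      by fun_prop
    have hmaps : MapsTo (fun p : ℝ × EuclideanSpace ℝ (Fin 3) => (p.1 + T, p.2)) (Iio 0 ×ˢ univ) (Iio 0 ×ˢ univ) :=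
      fun p hp => ⟨by have := (mem_prod.1 hp).1; simp only [mem_Iio] at this ⊢; linarith, mem_univ _⟩
    exact (hc.comp hmap hmaps).congr fun p _ => rfl
  · obtain ⟨K, hKb⟩ := hK
    exact ⟨K, fun t ht x => hKb (t + T) (by linarith) x⟩
  · have h := hm (s + T) (t + T) (by linarith) (by linarith) x
    have hD : oseenDuhamel 1 s (fun τ => v (τ + T)) (fun τ => v (τ + T)) t x =
        oseenDuhamel 1 (s + T) v v (t + T) x := by
      have h2 := oseenDuhamel_comp_sub_right 1 s t (-T) v v x
      simp only [sub_neg_eq_add] at h2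
      exact h2
    rw [hD, h]
    congr 2
    ring

/-- A class-P flow which is constant on a far past `(−∞,T) × ℝ³` is constant on all of `(−∞,0) × ℝ³`
(one-slice forward rigidity `TypeILiouvilleShoreline.classP_const_after_of_const_slice` from the slice `T − 1`; any `T`).
[cite: LemarieRieusset2016, Thm. 9.12] -/
theorem classP_const_of_const_below
    {v : ℝ → EuclideanSpace ℝ (Fin 3) → EuclideanSpace ℝ (Fin 3)}
    (hc : ContinuousOn (uncurry v) (Iio 0 ×ˢ univ))
    (hK : ∃ K : ℝ, ∀ t < 0, ∀ x, ‖v t x‖ ≤ K)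
    (hm : ∀ s t : ℝ, s < t → t < 0 → ∀ x,
      v t x = heatExtension (v s) (t - s) x - oseenDuhamel 1 s v v t x)
    {T : ℝ} {b : EuclideanSpace ℝ (Fin 3)} (hb : ∀ τ < T, ∀ x, v τ x = b) :
    ∀ t < 0, ∀ x, v t x = b := by
  intro t ht x
  rcases lt_or_ge t T with h | h
  · exact hb t h x
  · have hslice : ∀ y, v (T - 1) y = b := fun y => hb (T - 1) (by linarith) y
    exact TypeILiouvilleShoreline.classP_const_after_of_const_slice hc hK hm hslice t ⟨by linarith, ht⟩ x

/-- **STRETCHING FLOOR BELOW A TIME.**  If a class-P flow is NOT constant on `(−∞,T) × ℝ³` (`T ≤ 0`), then for every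
`a < 1` there are `τ < T` and `x` with `(T − τ)·‖∇v(τ,x)‖ > a` (else the time-shifted flow `t ↦ v(t+T)` obeys
`‖∇‖ ≤ a/(−t)` and is constant by the harmonic gradient floor `const_of_norm_fderiv_le_div`).
[cite: MajdaBertozzi2002, eq. (3.80)] -/
theorem exists_stretching_gt_of_nonconst_below
    {v : ℝ → EuclideanSpace ℝ (Fin 3) → EuclideanSpace ℝ (Fin 3)}
    (hc : ContinuousOn (uncurry v) (Iio 0 ×ˢ univ))
    (hK : ∃ K : ℝ, ∀ t < 0, ∀ x, ‖v t x‖ ≤ K)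
    (hd : ∀ t < 0, IsWeaklyDivFree (v t))
    (hm : ∀ s t : ℝ, s < t → t < 0 → ∀ x,
      v t x = heatExtension (v s) (t - s) x - oseenDuhamel 1 s v v t x)
    {T : ℝ} (hT : T ≤ 0) (hne : ¬ ∃ b : EuclideanSpace ℝ (Fin 3), ∀ τ < T, ∀ x, v τ x = b)
    {a : ℝ} (ha1 : a < 1) :
    ∃ τ : ℝ, τ < T ∧ ∃ x : EuclideanSpace ℝ (Fin 3), a < (T - τ) * ‖fderiv ℝ (v τ) x‖ := by
  by_contra hcon
  push Not at hcon
  obtain ⟨hc', hK', hd', hm'⟩ := classP_timeShift hc hK hd hm hT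
  have hg : ∀ t < 0, ∀ x : EuclideanSpace ℝ (Fin 3), ‖fderiv ℝ (v (t + T)) x‖ ≤ a / (-t) := by
    intro t ht x
    have ht0 : 0 < -t := neg_pos.2 ht
    have h := hcon (t + T) (by linarith) x
    rw [le_div_iff₀ ht0]
    have : (T - (t + T)) = -t := by ring
    rw [this] at h
    linarith [mul_comm (-t) ‖fderiv ℝ (v (t + T)) x‖]
  obtain ⟨b, hb⟩ := const_of_norm_fderiv_le_div (v := fun t x => v (t + T) x) hc' hK' hd' hm' ha1 hg
  refine hne ⟨b, fun τ hτ x => ?_⟩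
  have h := hb (τ - T) (by linarith) x
  simp only [sub_add_cancel] at h
  exact h

/-- **STRETCHING FLOOR OF A NON-CONSTANT BOUNDED ANCIENT FLOW.**  For a NON-CONSTANT class-P flow, every `T < 0` and
every `a < 1`: there are `τ < T` and `x` with `(T − τ)·‖∇v(τ,x)‖ > a` — hence also `(−τ)·‖∇v(τ,x)‖ > a`.  (Non-constancy
on `(−∞,0)` transfers to `(−∞,T)` by one-slice forward rigidity `classP_const_after_of_const_slice`.)  Contrapositive
reading: `limsup_{τ→−∞} (−τ)·sup_x‖∇v(τ,x)‖ < 1` forces constancy — the unit stretching threshold of the Type-I door on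
print's bounded class. [cite: MajdaBertozzi2002, eq. (3.80); LemarieRieusset2016, Thm. 9.12] -/
theorem exists_stretching_gt_of_nonconst
    {v : ℝ → EuclideanSpace ℝ (Fin 3) → EuclideanSpace ℝ (Fin 3)}
    (hc : ContinuousOn (uncurry v) (Iio 0 ×ˢ univ))
    (hK : ∃ K : ℝ, ∀ t < 0, ∀ x, ‖v t x‖ ≤ K)
    (hd : ∀ t < 0, IsWeaklyDivFree (v t))
    (hm : ∀ s t : ℝ, s < t → t < 0 → ∀ x,
      v t x = heatExtension (v s) (t - s) x - oseenDuhamel 1 s v v t x)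
    (hne : ¬ ∃ b : EuclideanSpace ℝ (Fin 3), ∀ t < 0, ∀ x, v t x = b)
    {T : ℝ} (hT : T < 0) {a : ℝ} (ha1 : a < 1) :
    ∃ τ : ℝ, τ < T ∧ ∃ x : EuclideanSpace ℝ (Fin 3),
      a < (T - τ) * ‖fderiv ℝ (v τ) x‖ ∧ a < (-τ) * ‖fderiv ℝ (v τ) x‖ := by
  have hneT : ¬ ∃ b : EuclideanSpace ℝ (Fin 3), ∀ τ < T, ∀ x, v τ x = b := fun ⟨b, hb⟩ =>
    hne ⟨b, classP_const_of_const_below hc hK hm (T := T) hb⟩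
  obtain ⟨τ, hτ, x, hx⟩ := exists_stretching_gt_of_nonconst_below hc hK hd hm hT.le hneT ha1
  refine ⟨τ, hτ, x, hx, lt_of_lt_of_le hx ?_⟩
  exact mul_le_mul_of_nonneg_right (by linarith) (norm_nonneg _)

/-- Filter form: in a NON-CONSTANT class-P flow, for every `a < 1`, **frequently as `τ → −∞`** some point carries
stretching number `(−τ)·‖∇v(τ,x)‖ > a`. [cite: MajdaBertozzi2002, eq. (3.80)] -/
theorem frequently_stretching_gt_of_nonconst
    {v : ℝ → EuclideanSpace ℝ (Fin 3) → EuclideanSpace ℝ (Fin 3)}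
    (hc : ContinuousOn (uncurry v) (Iio 0 ×ˢ univ))
    (hK : ∃ K : ℝ, ∀ t < 0, ∀ x, ‖v t x‖ ≤ K)
    (hd : ∀ t < 0, IsWeaklyDivFree (v t))
    (hm : ∀ s t : ℝ, s < t → t < 0 → ∀ x,
      v t x = heatExtension (v s) (t - s) x - oseenDuhamel 1 s v v t x)
    (hne : ¬ ∃ b : EuclideanSpace ℝ (Fin 3), ∀ t < 0, ∀ x, v t x = b) {a : ℝ} (ha1 : a < 1) :
    ∃ᶠ τ in atBot, ∃ x : EuclideanSpace ℝ (Fin 3), a < (-τ) * ‖fderiv ℝ (v τ) x‖ := by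
  rw [Filter.frequently_atBot]
  intro T
  obtain ⟨τ, hτ, x, -, hx⟩ := exists_stretching_gt_of_nonconst hc hK hd hm hne
    (T := min T (-1)) (lt_of_le_of_lt (min_le_right _ _) (by norm_num)) ha1
  exact ⟨τ, (hτ.le.trans (min_le_left _ _)), x, hx⟩

/-- The same floor in the contrapositive, as a Liouville theorem: a class-P flow whose stretching number is eventually
subcritical in the past — some `a < 1` and `T < 0` with `(−τ)·‖∇v(τ,x)‖ ≤ a` for all `τ < T`, `x` — is one constant
vector. [cite: MajdaBertozzi2002, eq. (3.80)] -/
theorem const_of_eventually_stretching_le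
    {v : ℝ → EuclideanSpace ℝ (Fin 3) → EuclideanSpace ℝ (Fin 3)}
    (hc : ContinuousOn (uncurry v) (Iio 0 ×ˢ univ))
    (hK : ∃ K : ℝ, ∀ t < 0, ∀ x, ‖v t x‖ ≤ K)
    (hd : ∀ t < 0, IsWeaklyDivFree (v t))
    (hm : ∀ s t : ℝ, s < t → t < 0 → ∀ x,
      v t x = heatExtension (v s) (t - s) x - oseenDuhamel 1 s v v t x)
    {a T : ℝ} (ha1 : a < 1) (hT : T < 0)
    (hsmall : ∀ τ < T, ∀ x : EuclideanSpace ℝ (Fin 3), (-τ) * ‖fderiv ℝ (v τ) x‖ ≤ a) :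
    ∃ b : EuclideanSpace ℝ (Fin 3), ∀ t < 0, ∀ x, v t x = b := by
  by_contra hne
  obtain ⟨τ, hτ, x, -, hx⟩ := exists_stretching_gt_of_nonconst hc hK hd hm hne hT ha1
  exact absurd (hsmall τ hτ x) (not_le.2 hx)

/-- **THE TYPE-I DOOR'S TWO DIALS ON PRINT'S CLASS, EVENTUALLY.**  A class-P flow whose vorticity decays on a far past
like `‖curl v(τ,x)‖ ≤ M(−τ)^{−β}` and whose stretching form obeys `⟪∇v(τ,x)ξ,ξ⟫ ≤ (a/(−τ))‖ξ‖²` there (`τ < T ≤ 0`),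
with `0 ≤ a < β`, is one constant vector (time shift by `T` + `const_of_stretching_lt_vorticity_decay` + forward
rigidity).  The Type-I mild class has `β = 1` for free; on print's class `β` is a genuine second dial.
[cite: MajdaBertozzi2002, eq. (3.80); LemarieRieusset2016, Thm. 9.12] -/
theorem const_of_eventually_stretching_lt_vorticity_decay
    {v : ℝ → EuclideanSpace ℝ (Fin 3) → EuclideanSpace ℝ (Fin 3)}
    (hc : ContinuousOn (uncurry v) (Iio 0 ×ˢ univ))
    (hK : ∃ K : ℝ, ∀ t < 0, ∀ x, ‖v t x‖ ≤ K)
    (hd : ∀ t < 0, IsWeaklyDivFree (v t))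
    (hm : ∀ s t : ℝ, s < t → t < 0 → ∀ x,
      v t x = heatExtension (v s) (t - s) x - oseenDuhamel 1 s v v t x)
    {a β M T : ℝ} (ha : 0 ≤ a) (haβ : a < β) (hM : 0 ≤ M) (hT : T ≤ 0)
    (hstr : ∀ τ < T, ∀ x ξ : EuclideanSpace ℝ (Fin 3), ⟪fderiv ℝ (v τ) x ξ, ξ⟫ ≤ a / (-τ) * ‖ξ‖ ^ 2)
    (hω : ∀ τ < T, ∀ x : EuclideanSpace ℝ (Fin 3), ‖curl (v τ) x‖ ≤ M * (-τ) ^ (-β)) :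
    ∃ b : EuclideanSpace ℝ (Fin 3), ∀ t < 0, ∀ x, v t x = b := by
  have hβ : 0 < β := lt_of_le_of_lt ha haβ
  obtain ⟨hc', hK', hd', hm'⟩ := classP_timeShift hc hK hd hm hT
  have hstr' : ∀ t < 0, ∀ x ξ : EuclideanSpace ℝ (Fin 3),
      ⟪fderiv ℝ (v (t + T)) x ξ, ξ⟫ ≤ a / (-t) * ‖ξ‖ ^ 2 := by
    intro t ht x ξ
    have ht0 : 0 < -t := neg_pos.2 ht
    have h := hstr (t + T) (by linarith) x ξ
    have hle : a / (-(t + T)) ≤ a / (-t) := div_le_div_of_nonneg_left ha ht0 (by linarith)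
    exact h.trans (mul_le_mul_of_nonneg_right hle (sq_nonneg _))
  have hω' : ∀ t < 0, ∀ x : EuclideanSpace ℝ (Fin 3), ‖curl (v (t + T)) x‖ ≤ M * (-t) ^ (-β) := by
    intro t ht x
    have ht0 : 0 < -t := neg_pos.2 ht
    have h := hω (t + T) (by linarith) x
    have hle : (-(t + T)) ^ (-β) ≤ (-t) ^ (-β) :=
      Real.rpow_le_rpow_of_nonpos ht0 (by linarith) (by linarith)
    exact h.trans (mul_le_mul_of_nonneg_left hle hM)
  obtain ⟨b, hb⟩ := const_of_stretching_lt_vorticity_decay (v := fun t x => v (t + T) x) hc' hK' hd' hm' haβ hstr' hω'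
  refine ⟨b, classP_const_of_const_below hc hK hm (T := T) fun τ hτ x => ?_⟩
  have h := hb (τ - T) (by linarith) x
  simp only [sub_add_cancel] at h
  exact h

end Summit.NavierStokesRegularity.NavierStokesRegularity.Theorems.TypeILiouvilleStrainLedger

end
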